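import Summits.Ventures.PercRepro.S1CoreCapProved
import Summits.Ventures.PercRepro.S1CoreCapSpecFiveCases

/-!
# PercRepro — THE `s₄` TABLE OF THE CAP BRIDGE, UNCONDITIONAL (p1, gen 24)

With `Q*(5) = 11` a kernel theorem (`FourCap.fourCapSpec_five`, `S1CoreCapSpecFiveCases`), every «modulo `Q*(5)`»
statement of `S1CoreCapProved` loses its hypothesis: on the e-free core of nullity `ν` the number of 4-circuits
through a point is `≤ 11` at `ν = 5` (`ncard_fourCircuitsThrough_le_eleven`), and `s₄ ≤ 29 / 49 / 73 / 105 / 147`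
at `ν = 5 / 6 / 7 / 8 / 9` and `≤ avgBound k` at `ν = k + 6` — with no `FourCapSpec` hypothesis anywhere. The
previous unconditional table (`S1CoreCapUncond`) read `33 / 57 / 85 / 122`. `proofs/P1-S4-CAPBRIDGE.md` §16.
Axioms: standard.
-/

open scoped Matroid

namespace PercRepro

namespace S1

open Set

open FourCap

variable {α : Type}

/-- The instances `j ≤ 5` of the spec are all kernel theorems. -/
theorem fourCapSpec_qStar_le_five_unconditional : ∀ j ≤ 5, FourCapSpec capPaper j (qStar j) :=
  fourCapSpec_qStar_le_five_of_five fourCapSpec_five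

/-- **At most `11` 4-circuits through any point of an e-free core of nullity `5`** (the bridge with `Q*(5) = 11`). -/
theorem ncard_fourCircuitsThrough_le_eleven (M : Matroid α) [M.Finite]
    (hfree : ∀ e ∈ M.E, ∃ A ⊆ M.E \ {e}, e ∉ M.closure A ∧ e ∉ M.closure ((M.E \ {e}) \ A))
    (hd : M.E.encard = M.eRank + 5) {e : α} (he : e ∈ M.E) :
    {C : Set α | M.IsCircuit C ∧ C.ncard = 4 ∧ e ∈ C}.ncard ≤ 11 :=
  ncard_fourCircuitsThrough_le_of_fourCapSpec M hfree hd he fourCapSpec_five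

/-- **`s₄ ≤ 29` on every e-free core of nullity `5`**, unconditionally. -/
theorem ncard_fourCircuits_le_twenty_nine_unconditional (M : Matroid α) [M.Finite]
    (hfree : ∀ e ∈ M.E, ∃ A ⊆ M.E \ {e}, e ∉ M.closure A ∧ e ∉ M.closure ((M.E \ {e}) \ A))
    (hd : M.E.encard = M.eRank + 5) : {C : Set α | M.IsCircuit C ∧ C.ncard = 4}.ncard ≤ 29 :=
  ncard_fourCircuits_le_twenty_nine_of_five M hfree hd fourCapSpec_five

/-- **`s₄ ≤ 49` on every e-free core of nullity `6`**, unconditionally (the cell `(12,6)`). -/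
theorem ncard_fourCircuits_le_forty_nine_unconditional (M : Matroid α) [M.Finite]
    (hfree : ∀ e ∈ M.E, ∃ A ⊆ M.E \ {e}, e ∉ M.closure A ∧ e ∉ M.closure ((M.E \ {e}) \ A))
    (hd : M.E.encard = M.eRank + 6) : {C : Set α | M.IsCircuit C ∧ C.ncard = 4}.ncard ≤ 49 :=
  ncard_fourCircuits_le_forty_nine_of_five M hfree hd fourCapSpec_five

/-- **`s₄ ≤ 73` on every e-free core of nullity `7`**, unconditionally (the cell `(11,7)`). -/
theorem ncard_fourCircuits_le_seventy_three_unconditional (M : Matroid α) [M.Finite]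
    (hfree : ∀ e ∈ M.E, ∃ A ⊆ M.E \ {e}, e ∉ M.closure A ∧ e ∉ M.closure ((M.E \ {e}) \ A))
    (hd : M.E.encard = M.eRank + 7) : {C : Set α | M.IsCircuit C ∧ C.ncard = 4}.ncard ≤ 73 :=
  ncard_fourCircuits_le_seventy_three_of_five M hfree hd fourCapSpec_five

/-- **`s₄ ≤ 105` on every e-free core of nullity `8`**, unconditionally (the cell `(11,8)`). -/
theorem ncard_fourCircuits_le_one_hundred_five_unconditional (M : Matroid α) [M.Finite]
    (hfree : ∀ e ∈ M.E, ∃ A ⊆ M.E \ {e}, e ∉ M.closure A ∧ e ∉ M.closure ((M.E \ {e}) \ A))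
    (hd : M.E.encard = M.eRank + 8) : {C : Set α | M.IsCircuit C ∧ C.ncard = 4}.ncard ≤ 105 :=
  ncard_fourCircuits_le_one_hundred_five_of_five M hfree hd fourCapSpec_five

/-- **`s₄ ≤ 147` on every e-free core of nullity `9`**, unconditionally. -/
theorem ncard_fourCircuits_le_one_hundred_forty_seven_unconditional (M : Matroid α) [M.Finite]
    (hfree : ∀ e ∈ M.E, ∃ A ⊆ M.E \ {e}, e ∉ M.closure A ∧ e ∉ M.closure ((M.E \ {e}) \ A))
    (hd : M.E.encard = M.eRank + 9) : {C : Set α | M.IsCircuit C ∧ C.ncard = 4}.ncard ≤ 147 :=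
  ncard_fourCircuits_le_one_hundred_forty_seven_of_five M hfree hd fourCapSpec_five

/-- **`s₄ ≤ avgBound k` on every e-free core of nullity `k + 6`**, unconditionally. -/
theorem ncard_fourCircuits_le_avgBound_unconditional (k : ℕ) (M : Matroid α) [M.Finite]
    (hfree : ∀ e ∈ M.E, ∃ A ⊆ M.E \ {e}, e ∉ M.closure A ∧ e ∉ M.closure ((M.E \ {e}) \ A))
    (hd : M.E.encard = M.eRank + (k + 6)) : {C : Set α | M.IsCircuit C ∧ C.ncard = 4}.ncard ≤ avgBound k :=
  ncard_fourCircuits_le_avgBound_of_five k M hfree hd fourCapSpec_five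

end S1

end PercRepro
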